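import Summits.AtomisticToContinuum.Crystallization.Theorems.ChargedEnergyGap.Negative.Periodisation
import Summits.AtomisticToContinuum.Crystallization.Theorems.ChargedEnergyGap.Negative.Tolerance
import Summits.AtomisticToContinuum.Crystallization.Theorems.ChargedEnergyGap.Negative.BlocksBound

/-!
# `ChargedEnergyGap` (stmt-AtomisticToContinuum-14231), negative side VI: everything unconditional; item 0626

With item 0714 proved (`bddBelow_energyPerParticle_lennardJones`, part BlocksBound) and the
trial states of `exists_trialState`, the conditional results of parts III–IV become
unconditional: `N·e* ≤ E_LJ(y)` for every finite injective `y` (`GapWith η 0 0` for every `η`),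
the crux is EXACTLY a uniform price per charged site on the non-negative excess, and the priced
gap is false at every tolerance `η ≤ 0`.  Moreover the energetic crystallization statement in
the form shared by the board, **item 0626 `CrysEnergyLimit`**
(`E(N)/N → ⨅_Q e(Q)`), follows: `e_∞ ≤ ⨅ e` by the trial-state bound
(`le_energyPerParticle_of_tendsto`) and
`⨅ e ≤ E(N)/N` for all `N ≥ 1` by periodisation.  All `[folklore]`.
-/

noncomputable section

namespace Summit.AtomisticToContinuum.Crystallization.Theorems.ChargedEnergyGapNegative

open Literature.MathematicalPhysics.StatisticalMechanics
open Literature.Geometry.DiscreteGeometry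
open Summit.AtomisticToContinuum.Crystallization.Theses.PricedLinkCensus
open scoped BigOperators

/-- **`N·e* ≤ E_LJ(y)` for every finite injective configuration of `ℝ³`** (unconditionally).
[folklore] -/
theorem card_mul_eStar_le {N : ℕ} {y : Fin N → E3} (hy : Function.Injective y) :
    (N : ℝ) * eStar ≤ interactionEnergy lennardJones y :=
  card_mul_eStar_le_interactionEnergy bddBelow_energyPerParticle_lennardJones hy

/-- Hence the `κ = 0` gap holds with `C = 0` at every tolerance. [folklore] -/
theorem gapWith_zero_zero (η : ℝ) : GapWith η 0 0 :=
  (gapWith_zero_zero_iff η).2 bddBelow_energyPerParticle_lennardJones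

/-- **The crux is exactly a uniform price per charged site on the excess energy**
`E_LJ(y) − N·e* ≥ 0`. [folklore] -/
theorem chargedEnergyGap_iff_price :
    ChargedEnergyGap ↔ ∃ κ : ℝ, 0 < κ ∧ ∀ (N : ℕ) (y : Fin N → E3), Function.Injective y →
      κ * (charged (1 / 100) y : ℝ) ≤ interactionEnergy lennardJones y - (N : ℝ) * eStar := by
  rw [chargedEnergyGap_iff_pricing]
  exact ⟨fun h => h.2, fun h => ⟨bddBelow_energyPerParticle_lennardJones, h⟩⟩

/-- The excess energy of every finite injective configuration is non-negative. [folklore] -/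
theorem excess_nonneg {N : ℕ} {y : Fin N → E3} (hy : Function.Injective y) :
    0 ≤ interactionEnergy lennardJones y - (N : ℝ) * eStar := by
  linarith [card_mul_eStar_le hy]

/-- **The tolerance is load-bearing, unconditionally**: with `η ≤ 0` the priced gap is false for
every `κ > 0` and every `C`. [folklore] -/
theorem not_gapWith_of_eta_nonpos' {η κ : ℝ} (hη : η ≤ 0) (hκ : 0 < κ) (C : ℝ) :
    ¬ GapWith η κ C := by
  rcases hη.lt_or_eq with hη | rfl
  · exact not_gapWith_of_eta_neg (fun _ hδ => exists_trialState hδ) hη hκ C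
  · exact not_gapWith_eta_zero (fun _ hδ => exists_trialState hδ) hκ C

/-- `⨅ e ≤ E(N)/N` for every `N ≥ 1` (Lennard-Jones, `ℝ³`). [folklore] -/
theorem eStar_le_groundStateEnergy_div {N : ℕ} (hN : 0 < N) :
    eStar ≤ groundStateEnergy lennardJones 3 N / N := by
  have hNr : (0 : ℝ) < N := by exact_mod_cast hN
  rw [le_div_iff₀ hNr, mul_comm]
  haveI := nonempty_injective_config (by norm_num : 0 < 3) N
  exact le_ciInf fun x => card_mul_eStar_le x.2

/-- **Item 0626 `CrysEnergyLimit`** — the energetic half of crystallization in the form used by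
the board: `E(N)/N → ⨅_Q e_LJ(Q)` for Lennard-Jones in `ℝ³` (the thermodynamic limit `e_∞`
exists by `BlancLewin2015_8_holds`; `e_∞ ≤ ⨅ e` by `crysEnergyUpper`; `⨅ e ≤ E(N)/N` by
periodisation).  NOTE: this identifies `lim E(N)/N` with the periodic INFIMUM; that the infimum
is ATTAINED (a periodic minimiser) is the open content of `HasPeriodicGroundStateEnergy`.
[folklore] -/
theorem crysEnergyLimit :
    Filter.Tendsto (fun N : ℕ => groundStateEnergy lennardJones 3 N / N) Filter.atTop
      (nhds (⨅ Q : PeriodicConfiguration 3, Q.energyPerParticle lennardJones)) := by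
  obtain ⟨e, -, htend, -⟩ := BlancLewin2015_8_holds 3 (by norm_num) (by norm_num)
  have hup : e ≤ eStar := le_ciInf fun Q => le_energyPerParticle_of_tendsto htend Q
  have hdown : eStar ≤ e :=
    ge_of_tendsto htend (Filter.eventually_atTop.2 ⟨1, fun N hN =>
      eStar_le_groundStateEnergy_div hN⟩)
  have heq : e = eStar := le_antisymm hup hdown
  rw [heq] at htend
  exact htend

end Summit.AtomisticToContinuum.Crystallization.Theorems.ChargedEnergyGapNegative

end
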